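import Summits.ResolutionOfSingularities.ResolutionOfSingularities.Theorems.FrobeniusLadderFInjectiveMacaulayficationX2Cubic4FloorTwoCharts
import Summits.ResolutionOfSingularities.ResolutionOfSingularities.Theorems.FrobeniusLadderFInjectiveMacaulayficationX2Cubic4SingularCentre
import Summits.ResolutionOfSingularities.ResolutionOfSingularities.Theorems.FrobeniusLadderFInjectiveMacaulayficationX2Cubic4PointFloor
import Summits.ResolutionOfSingularities.ResolutionOfSingularities.Theorems.FrobeniusLadderFInjectiveMacaulayficationE4FloorTwoGlue
import HarnessLib

/-!
# (RR-I2) floor 2 glue + (ROW): every blowing up of `Y₁ = Bl_𝔪 Y`, `Y = {x² + y³ + u³ + t³ + s³}`, along the reduced singular locus `𝓚_Σ` IS REGULAR, and the T″(p,4,·)-instance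
# row `tStepInstanceAt_x2cubic4_origin` — for EVERY field with `2, 3 ≠ 0` (all characteristics `p ≥ 5`)
# (crux `FInjectiveMacaulayfication` stmt-ResolutionOfSingularities-15315, chain w45a; the SECOND T″-side kernel instance after E4″@G (res-L1-w45a-stub-1 g11 ✓ `E4FloorTwoGlue.
# tStepInstanceAt_G_origin`, char 2) and the first valid in all large characteristics; bed memo `Cruxes/…/Lines/RR-I2-bed-x2y3u3t3s3.md`; seat res-L1-w45a-lead-1 g11)

[OURS · L1 W4.5a] Support file (`--supports stmt-ResolutionOfSingularities-15315 --as helper`); replaces the role of NO printed item; NOT a statement of any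
manuscript; def-free; UNCONDITIONAL. AI-written (AI review is weaker than expert review).

* §1 per-chart data `chart_comap_and_isRegular`: for the five charts of `Bl_𝔪 Y` (strict transforms `G i` of res-L1-w45a-lead-1 g10's `X2Cubic4PointFloor.theta`; centres `CC i`
  = `(X₄, Xᵢ, 1 + Σ_{j ∉ {i,4}} Xⱼ³)` on `D₊(y), D₊(u), D₊(t), D₊(s)` and the unit ideal on the regular chart `D₊(x)`) and ANY open immersion `ι : Spec k[X]/(G i) → Y₁`:
  `(vanishingIdeal Z).comap ι = J̃_i` (`E4FloorTwoGlue.comap_vanishingIdeal_eq_idealSheaf` over `Sing = V(J_i)`, `J_i` prime) and `Bl_{J_i} Spec k[X]/(G i)` is a regular scheme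
  (`X2Cubic4FloorTwoYChart`, `X2Cubic4FloorTwoCharts`).
* §2 ★★ `isRegular_of_isBlowup_vanishingIdeal` — **every blowing up of `Y₁` along `𝓚_Σ = vanishingIdeal Z`, `↑Z = (Reg Y₁)ᶜ`, is a regular scheme** (the five charts
  `StrictTransformChartN` + `affineBlowup.chartι` cover `Y₁`; glue by `E4FloorTwoGlue.isRegular_of_isBlowup_of_charts`).
* §3 ★★★ (ROW) `tStepInstanceAt_x2cubic4_origin` — `TStepInstanceAt p v (𝔪̃·𝒪_{Y,v})` for every `p` and every field with `2, 3 ≠ 0`; `tStepInstanceAt_x2cubic4_origin_charP` — the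
  same for every prime `p ∉ {2, 3}` and every field of characteristic `p`: via res-L1-w45a-stub-3's bridge `TStepGerm.tStepInstanceAt_of_isBlowup` with the binders of
  `X2Cubic4SingularCentre`, existence of blowing ups, and §2. With g10's ✓ `X2Cubic4PointFloor.pointFloor_x2cubic4_input_legal` the point floor is a LEGAL input (admissible,
  regular off the fibre, CM); its FULLness (vertex and floor along `Σ`) — which makes the instance non-vacuous — is NOT proved here (Fedder cells at generic `p`, flagged in the memo).
  ONE instance; evidence for nothing beyond itself; the T″ stub `stub_localRegularizationFibreFullTr` stays OPEN.
[folklore assembly; cite: GortzWedhorn2020, Prop. 13.91 (2), Prop. 13.92, (13.19); Liu2002, Thm. 8.1.19 (a); StacksProject, Tag 0804; Temkin2008, §2.1]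
-/

-- single-problem summit: the doubled namespace component is forced
set_option linter.dupNamespace false

noncomputable section

namespace Summit.ResolutionOfSingularities.ResolutionOfSingularities.Theorems.FInjectiveMacaulayfication.X2Cubic4FloorTwoGlue

open MvPolynomial Literature.AlgebraicGeometry.Resolution AlgebraicGeometry CategoryTheory CategoryTheory.Limits TopologicalSpace
open Summit.ResolutionOfSingularities.ResolutionOfSingularities.Theorems.FInjectiveMacaulayfication

/-! ## §1 Per-chart data -/

/-- **Per-chart data.** For each of the five charts of `Bl_𝔪 Y` (strict transforms `G i`, centres `CC i`: `(X₄, Xᵢ, wᵢ)` on `D₊(Xᵢ)`, `i ≤ 3`, and the unit ideal on the regular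
chart `D₊(x) = D₊(X₄)`), and ANY open immersion `ι : Spec k[X]/(G i) → Y₁`: `(vanishingIdeal Z).comap ι = J̃_i` and `Bl_{J_i} Spec k[X]/(G i)` is a regular scheme (`3 ≠ 0` in `k`).
[folklore; cite: Liu2002, Thm. 8.1.19 (a)] -/
theorem chart_comap_and_isRegular (k : Type) [Field k] (h3 : (3 : k) ≠ 0) {X₁ : Scheme.{0}}
    (Z : Closeds ↥X₁) (hZ : (Z : Set ↥X₁) = (Scheme.regularLocus X₁)ᶜ)
    (G : Fin 5 → MvPolynomial (Fin 5) k)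
    (hG : G = ![X 4 ^ 2 + X 0 + X 0 * X 1 ^ 3 + X 0 * X 2 ^ 3 + X 0 * X 3 ^ 3,
        X 4 ^ 2 + X 1 * X 0 ^ 3 + X 1 + X 1 * X 2 ^ 3 + X 1 * X 3 ^ 3,
        X 4 ^ 2 + X 2 * X 0 ^ 3 + X 2 * X 1 ^ 3 + X 2 + X 2 * X 3 ^ 3,
        X 4 ^ 2 + X 3 * X 0 ^ 3 + X 3 * X 1 ^ 3 + X 3 * X 2 ^ 3 + X 3,
        1 + X 4 * X 0 ^ 3 + X 4 * X 1 ^ 3 + X 4 * X 2 ^ 3 + X 4 * X 3 ^ 3])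
    (CC : Fin 5 → Fin 3 → MvPolynomial (Fin 5) k)
    (hCC : CC = ![![X 4, X 0, 1 + X 1 ^ 3 + X 2 ^ 3 + X 3 ^ 3], ![X 4, X 1, 1 + X 0 ^ 3 + X 2 ^ 3 + X 3 ^ 3],
        ![X 4, X 2, 1 + X 0 ^ 3 + X 1 ^ 3 + X 3 ^ 3], ![X 4, X 3, 1 + X 0 ^ 3 + X 1 ^ 3 + X 2 ^ 3], ![1, 1, 1]])
    (i : Fin 5) : ∀ (ι : Spec (.of (MvPolynomial (Fin 5) k ⧸ Ideal.span {G i})) ⟶ X₁) [IsOpenImmersion ι],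
    (Scheme.IdealSheafData.vanishingIdeal Z).comap ι =
        affineBlowup.idealSheaf ((Ideal.span (Set.range (CC i))).map (Ideal.Quotient.mk (Ideal.span {G i}))) ∧
      Scheme.IsRegular (affineBlowup ((Ideal.span (Set.range (CC i))).map (Ideal.Quotient.mk (Ideal.span {G i})))) := by
  -- the regular chart: centre = unit ideal
  have unit_chart : ∀ (g : MvPolynomial (Fin 5) k) (c : Fin 3 → MvPolynomial (Fin 5) k), c 0 = 1 → IsRegularRing (MvPolynomial (Fin 5) k ⧸ Ideal.span {g}) →
      ∀ (j : Spec (.of (MvPolynomial (Fin 5) k ⧸ Ideal.span {g})) ⟶ X₁) [IsOpenImmersion j],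
      (Scheme.IdealSheafData.vanishingIdeal Z).comap j =
          affineBlowup.idealSheaf ((Ideal.span (Set.range c)).map (Ideal.Quotient.mk (Ideal.span {g}))) ∧
        Scheme.IsRegular (affineBlowup ((Ideal.span (Set.range c)).map (Ideal.Quotient.mk (Ideal.span {g})))) := by
    intro g c hc hreg j _
    have htop : (Ideal.span (Set.range c)).map (Ideal.Quotient.mk (Ideal.span {g})) = ⊤ := by
      rw [Ideal.eq_top_iff_one, ← map_one (Ideal.Quotient.mk (Ideal.span {g}))]
      exact Ideal.mem_map_of_mem _ (Ideal.subset_span ⟨0, hc⟩)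
    rw [htop]
    refine ⟨E4FloorTwoGlue.comap_vanishingIdeal_eq_idealSheaf Z hZ j ⊤ (Ideal.radical_top _) fun P hP => ?_, E4FloorTwoGlue.isRegular_affineBlowup_top⟩
    exact ⟨fun h => (h (IsRegularRing.isRegularLocalRing_localization P)).elim, fun h => (hP.ne_top (top_le_iff.mp h)).elim⟩
  fin_cases i
  · intro ι hι
    have hG0 : G 0 = X 4 ^ 2 + X 0 + X 0 * X 1 ^ 3 + X 0 * X 2 ^ 3 + X 0 * X 3 ^ 3 := by rw [hG]; rfl
    have hC0 : CC 0 = ![X 4, X 0, 1 + X 1 ^ 3 + X 2 ^ 3 + X 3 ^ 3] := by rw [hCC]; rfl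
    exact ⟨@E4FloorTwoGlue.comap_vanishingIdeal_eq_idealSheaf _ Z hZ _ _ ι hι _ (X2Cubic4FloorTwoYChart.isPrime_yChart k h3 (G 0) hG0 (CC 0) hC0 _ rfl).radical
        fun P hP => @X2Cubic4FloorTwoYChart.not_isRegularLocalRing_iff_yChart k _ h3 (G 0) hG0 (CC 0) hC0 _ rfl P hP,
      X2Cubic4FloorTwoYChart.isRegular_affineBlowup_yChart k h3 (G 0) hG0 (CC 0) hC0 _ rfl⟩
  · intro ι hι
    have hG1 : G 1 = X 4 ^ 2 + X 1 * X 0 ^ 3 + X 1 + X 1 * X 2 ^ 3 + X 1 * X 3 ^ 3 := by rw [hG]; rfl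
    have hC1 : CC 1 = ![X 4, X 1, 1 + X 0 ^ 3 + X 2 ^ 3 + X 3 ^ 3] := by rw [hCC]; rfl
    obtain ⟨-, hsing, hpr, -⟩ := X2Cubic4FloorTwoCharts.chartOne k h3 (G 1) hG1 (CC 1) hC1 _ rfl
    exact ⟨@E4FloorTwoGlue.comap_vanishingIdeal_eq_idealSheaf _ Z hZ _ _ ι hι _ hpr.radical fun P hP => @hsing P hP,
      X2Cubic4FloorTwoCharts.isRegular_affineBlowup_chartOne k h3 (G 1) hG1 (CC 1) hC1 _ rfl⟩
  · intro ι hι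
    have hG2 : G 2 = X 4 ^ 2 + X 2 * X 0 ^ 3 + X 2 * X 1 ^ 3 + X 2 + X 2 * X 3 ^ 3 := by rw [hG]; rfl
    have hC2 : CC 2 = ![X 4, X 2, 1 + X 0 ^ 3 + X 1 ^ 3 + X 3 ^ 3] := by rw [hCC]; rfl
    obtain ⟨-, hsing, hpr, -⟩ := X2Cubic4FloorTwoCharts.chartTwo k h3 (G 2) hG2 (CC 2) hC2 _ rfl
    exact ⟨@E4FloorTwoGlue.comap_vanishingIdeal_eq_idealSheaf _ Z hZ _ _ ι hι _ hpr.radical fun P hP => @hsing P hP,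
      X2Cubic4FloorTwoCharts.isRegular_affineBlowup_chartTwo k h3 (G 2) hG2 (CC 2) hC2 _ rfl⟩
  · intro ι hι
    have hG3 : G 3 = X 4 ^ 2 + X 3 * X 0 ^ 3 + X 3 * X 1 ^ 3 + X 3 * X 2 ^ 3 + X 3 := by rw [hG]; rfl
    have hC3 : CC 3 = ![X 4, X 3, 1 + X 0 ^ 3 + X 1 ^ 3 + X 2 ^ 3] := by rw [hCC]; rfl
    obtain ⟨-, hsing, hpr, -⟩ := X2Cubic4FloorTwoCharts.chartThree k h3 (G 3) hG3 (CC 3) hC3 _ rfl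
    exact ⟨@E4FloorTwoGlue.comap_vanishingIdeal_eq_idealSheaf _ Z hZ _ _ ι hι _ hpr.radical fun P hP => @hsing P hP,
      X2Cubic4FloorTwoCharts.isRegular_affineBlowup_chartThree k h3 (G 3) hG3 (CC 3) hC3 _ rfl⟩
  · -- the regular chart `D₊(x)`: centre = unit ideal
    intro ι hι
    exact @unit_chart (G 4) (CC 4) (by rw [hCC]; rfl) (X2Cubic4FloorTwoCharts.isRegularRing_chartFour k (G 4) (by rw [hG]; rfl)) ι hι

/-! ## §2 Every blowing up of `Bl_𝔪 Y` along the reduced singular locus is regular -/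

set_option maxHeartbeats 400000 in
/-- ★★ **EVERY BLOWING UP OF `Y₁ = Bl_𝔪 Y` ALONG `𝓚_Σ = vanishingIdeal Z`, `Z = (Reg Y₁)ᶜ`, IS A REGULAR SCHEME** (`Y = {X₄² + X₀³ + X₁³ + X₂³ + X₃³}`, any field with `3 ≠ 0`).
The five charts `ι_i : Spec k[X]/(G i) → Y₁` (`StrictTransformChartN.stub_strictTransformChartN` composed with `affineBlowup.chartι`) cover `Y₁`; on `D₊(x)` the chart is regular so
`𝓚_Σ| = ⊤̃` and `Bl_⊤` is regular; on `D₊(y), D₊(u), D₊(t), D₊(s)` `𝓚_Σ| = J̃_i` (`Sing = V(J_i)`, `J_i` prime) and `Bl_{J_i}` is regular; glue by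
`E4FloorTwoGlue.isRegular_of_isBlowup_of_charts`. [folklore; cite: GortzWedhorn2020, Prop. 13.91 (2); Liu2002, Thm. 8.1.19 (a)] -/
theorem isRegular_of_isBlowup_vanishingIdeal (k : Type) [Field k] (h3 : (3 : k) ≠ 0) (f : MvPolynomial (Fin 5) k)
    (hf : f = X 4 ^ 2 + X 0 ^ 3 + X 1 ^ 3 + X 2 ^ 3 + X 3 ^ 3)
    (𝔪 : Ideal (MvPolynomial (Fin 5) k ⧸ Ideal.span {f})) (h𝔪 : 𝔪 = Ideal.span (Set.range fun j : Fin 5 => Ideal.Quotient.mk (Ideal.span {f}) (X j)))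
    (Z : Closeds ↥(affineBlowup 𝔪)) (hZ : (Z : Set ↥(affineBlowup 𝔪)) = (Scheme.regularLocus (affineBlowup 𝔪))ᶜ)
    {X₂ : Scheme.{0}} (π₂ : X₂ ⟶ affineBlowup 𝔪) (hπ₂ : IsBlowup π₂ (Scheme.IdealSheafData.vanishingIdeal Z)) :
    Scheme.IsRegular X₂ := by
  subst h𝔪
  have hprime := X2Cubic4Specimen.prime_f k h3 f hf
  haveI hfprime : (Ideal.span {f}).IsPrime := (Ideal.span_singleton_prime hprime.ne_zero).mpr hprime
  -- the five strict transforms and centres (res-L1-w45a-lead-1 g10's table), kept opaque behind equations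
  obtain ⟨G, hG⟩ : ∃ G : Fin 5 → MvPolynomial (Fin 5) k,
      G = ![X 4 ^ 2 + X 0 + X 0 * X 1 ^ 3 + X 0 * X 2 ^ 3 + X 0 * X 3 ^ 3,
        X 4 ^ 2 + X 1 * X 0 ^ 3 + X 1 + X 1 * X 2 ^ 3 + X 1 * X 3 ^ 3,
        X 4 ^ 2 + X 2 * X 0 ^ 3 + X 2 * X 1 ^ 3 + X 2 + X 2 * X 3 ^ 3,
        X 4 ^ 2 + X 3 * X 0 ^ 3 + X 3 * X 1 ^ 3 + X 3 * X 2 ^ 3 + X 3,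
        1 + X 4 * X 0 ^ 3 + X 4 * X 1 ^ 3 + X 4 * X 2 ^ 3 + X 4 * X 3 ^ 3] := ⟨_, rfl⟩
  obtain ⟨CC, hCC⟩ : ∃ CC : Fin 5 → Fin 3 → MvPolynomial (Fin 5) k,
      CC = ![![X 4, X 0, 1 + X 1 ^ 3 + X 2 ^ 3 + X 3 ^ 3], ![X 4, X 1, 1 + X 0 ^ 3 + X 2 ^ 3 + X 3 ^ 3],
        ![X 4, X 2, 1 + X 0 ^ 3 + X 1 ^ 3 + X 3 ^ 3], ![X 4, X 3, 1 + X 0 ^ 3 + X 1 ^ 3 + X 2 ^ 3], ![1, 1, 1]] := ⟨_, rfl⟩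
  have hθ : ∀ i : Fin 5, MvPolynomial.aeval (fun j : Fin 5 => if j = i then (X i : MvPolynomial (Fin 5) k) else X j * X i) f = X i ^ 2 * G i := by
    intro i
    have hθi := X2Cubic4PointFloor.theta k f hf i
    dsimp only at hθi
    rw [hG]
    exact hθi
  have hfX := X2Cubic4Specimen.f_not_mem_span_X k f hf
  have hGX : ∀ i : Fin 5, G i ∉ Ideal.span {(X i : MvPolynomial (Fin 5) k)} := by
    rw [hG]; exact X2Cubic4PointFloor.g_not_mem_span_X k
  have hGprime : ∀ i : Fin 5, (Ideal.span {G i}).IsPrime := fun i =>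
    (PrimeTransfer.stub_primeTransfer k 5 i f (G i) 2 (hθ i) (hfX i) (hGX i)).mp hfprime
  have hXG : ∀ i : Fin 5, (X i : MvPolynomial (Fin 5) k) ∉ Ideal.span {G i} := fun i =>
    PrimeTransfer.X_not_mem_span_of_isPrime (hGprime i) (hGX i)
  -- the chart isomorphisms `k[X]/(G i) ≅ (A[𝔪t])_{(x̄ᵢt)}` and the open immersions `ι_i`
  have he : ∀ i : Fin 5, ∃ e : (MvPolynomial (Fin 5) k ⧸ Ideal.span {G i}) ≃+*
      HomogeneousLocalization.Away (reesGrading (Ideal.span (Set.range fun j : Fin 5 => Ideal.Quotient.mk (Ideal.span {f}) (X j))))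
        (reesT (Ideal.Quotient.mk (Ideal.span {f}) (X i)) (Ideal.subset_span (Set.mem_range_self i))),
      e (Ideal.Quotient.mk (Ideal.span {G i}) (X i)) =
        reesChartBase (Ideal.Quotient.mk (Ideal.span {f}) (X i)) (Ideal.subset_span (Set.mem_range_self i)) (Ideal.Quotient.mk (Ideal.span {f}) (X i)) :=
    fun i => StrictTransformChartN.stub_strictTransformChartN k 5 f (G i) i 2 hfprime hprime.ne_zero (hGprime i) (hXG i) (hθ i) _ rfl
  choose e _ using he
  refine E4FloorTwoGlue.isRegular_of_isBlowup_of_charts (Scheme.IdealSheafData.vanishingIdeal Z) hπ₂ (fun i : Fin 5 => MvPolynomial (Fin 5) k ⧸ Ideal.span {G i})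
    (fun i => Spec.map (e i).symm.toCommRingCatIso.hom ≫
      affineBlowup.chartι (Ideal.Quotient.mk (Ideal.span {f}) (X i)) (Ideal.subset_span (Set.mem_range_self i)))
    (fun x₁ => ?_) (fun i => (Ideal.span (Set.range (CC i))).map (Ideal.Quotient.mk (Ideal.span {G i})))
    (fun i => (chart_comap_and_isRegular k h3 Z hZ G hG CC hCC i _).1) (fun i => (chart_comap_and_isRegular k h3 Z hZ G hG CC hCC i
      (Spec.map (e i).symm.toCommRingCatIso.hom ≫ affineBlowup.chartι (Ideal.Quotient.mk (Ideal.span {f}) (X i)) (Ideal.subset_span (Set.mem_range_self i)))).2)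
  -- (COV) the charts `D₊(x̄ᵢ t)` cover `Y₁`
  have htop := affineBlowup.iSup_basicOpen_reesT_generators_eq_top (fun j : Fin 5 => Ideal.Quotient.mk (Ideal.span {f}) (X j))
  have hx : x₁ ∈ (⨆ i : Fin 5, Proj.basicOpen (reesGrading (Ideal.span (Set.range fun j : Fin 5 => Ideal.Quotient.mk (Ideal.span {f}) (X j))))
      (reesT (Ideal.Quotient.mk (Ideal.span {f}) (X i)) (Ideal.mem_span_range_self (f := fun j : Fin 5 => Ideal.Quotient.mk (Ideal.span {f}) (X j)) (x := i)))) := by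
    rw [htop]; trivial
  obtain ⟨i, hi⟩ := Opens.mem_iSup.mp hx
  rw [← affineBlowup.image_top_chartι] at hi
  obtain ⟨y, -, hy⟩ := hi
  obtain ⟨y', hy'⟩ := (Spec.map (e i).symm.toCommRingCatIso.hom).surjective y
  refine ⟨i, y', ?_⟩
  rw [Scheme.Hom.comp_apply, hy']
  exact hy

/-! ## §3 (ROW) the T″-instance `(Y, 𝔪)` at the vertex of `x² + y³ + u³ + t³ + s³` -/

/-- ★★★ **(ROW) `tStepInstanceAt_x2cubic4_origin` — THE SECOND T″(·,4,·)-INSTANCE IN THE KERNEL, THE FIRST IN ALL LARGE CHARACTERISTICS.** For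
`Y = Spec k[X₀..X₄]/(X₄² + X₀³ + X₁³ + X₂³ + X₃³)` over ANY field `k` with `2 ≠ 0`, `3 ≠ 0` and its vertex `v`, and for every `p`: `TStepInstanceAt p v (𝔪̃·𝒪_{Y,v})` — for every
blowing up `g : S′ → Spec 𝒪_{Y,v}` along the (pulled-back) vertex ideal which is regular off the closed fibre and FULL everywhere, there is a fibre-supported `𝓚 ≠ ⊥` on `S′` ALL of
whose blowing ups are regular schemes. Centre of record: `𝓚_Σ` = the reduced singular locus of `Bl_𝔪 Y` (the smooth Fermat cubic SURFACE `Σ` in the exceptional `ℙ³`, transversal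
type A₁); assembled from `X2Cubic4SingularCentre` (binders), res-L1-w45a-stub-3's bridge `TStepGerm.tStepInstanceAt_of_isBlowup` (p621847), existence of blowing ups, and §2. The
point floor is a LEGAL input by g10's ✓ `X2Cubic4PointFloor.pointFloor_x2cubic4_input_legal`; its FULLness (which makes the instance non-vacuous) is NOT proved here. ONE instance;
evidence for nothing beyond itself. [OURS; folklore assembly; cite: GortzWedhorn2020, Prop. 13.91 (2), Prop. 13.92; Liu2002, Thm. 8.1.19 (a)] -/
theorem tStepInstanceAt_x2cubic4_origin (k : Type) [Field k] (h2 : (2 : k) ≠ 0) (h3 : (3 : k) ≠ 0) (p : ℕ) (f : MvPolynomial (Fin 5) k)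
    (hf : f = X 4 ^ 2 + X 0 ^ 3 + X 1 ^ 3 + X 2 ^ 3 + X 3 ^ 3)
    (v : Spec (.of (MvPolynomial (Fin 5) k ⧸ Ideal.span {f})))
    (hv : v.asIdeal = Ideal.span (Set.range fun j : Fin 5 => Ideal.Quotient.mk (Ideal.span {f}) (X j)))
    (𝔪 : Ideal (MvPolynomial (Fin 5) k ⧸ Ideal.span {f})) (h𝔪 : 𝔪 = Ideal.span (Set.range fun j : Fin 5 => Ideal.Quotient.mk (Ideal.span {f}) (X j))) :
    TStepGerm.TStepInstanceAt p v ((affineBlowup.idealSheaf 𝔪).comap ((Spec (.of (MvPolynomial (Fin 5) k ⧸ Ideal.span {f}))).fromSpecStalk v)) := by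
  let Z : Closeds ↥(affineBlowup 𝔪) := ⟨(Scheme.regularLocus (affineBlowup 𝔪))ᶜ, E4GermSingularCentre.isClosed_compl_regularLocus k f 𝔪⟩
  have hZ : (Z : Set ↥(affineBlowup 𝔪)) = (Scheme.regularLocus (affineBlowup 𝔪))ᶜ := rfl
  obtain ⟨X₂, π₂, hπ₂⟩ := exists_isBlowup (affineBlowup 𝔪) (Scheme.IdealSheafData.vanishingIdeal Z)
  have hreg := isRegular_of_isBlowup_vanishingIdeal k h3 f hf 𝔪 h𝔪 Z hZ π₂ hπ₂
  exact TStepGerm.tStepInstanceAt_of_isBlowup p v (affineBlowup.isBlowup 𝔪) (Scheme.IdealSheafData.vanishingIdeal Z)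
    (X2Cubic4SingularCentre.comap_pullback_fst_vanishingIdeal_ne_bot k h2 h3 f hf v hv 𝔪 h𝔪 Z hZ)
    (X2Cubic4SingularCentre.support_vanishingIdeal_over_vertex k h2 h3 f hf v hv 𝔪 h𝔪 Z hZ) hπ₂ fun x₂ _ => hreg x₂

/-- ★★★ **(ROW, characteristic form)**: for every prime `p ∉ {2, 3}` and every field `k` of characteristic `p`, `TStepInstanceAt p v (𝔪̃·𝒪_{Y,v})` at the vertex of
`Y = {x² + y³ + u³ + t³ + s³} ⊂ 𝔸⁵_k`. [OURS; corollary] -/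
theorem tStepInstanceAt_x2cubic4_origin_charP (k : Type) [Field k] (p : ℕ) [Fact p.Prime] [CharP k p] (hp2 : p ≠ 2) (hp3 : p ≠ 3)
    (f : MvPolynomial (Fin 5) k) (hf : f = X 4 ^ 2 + X 0 ^ 3 + X 1 ^ 3 + X 2 ^ 3 + X 3 ^ 3)
    (v : Spec (.of (MvPolynomial (Fin 5) k ⧸ Ideal.span {f})))
    (hv : v.asIdeal = Ideal.span (Set.range fun j : Fin 5 => Ideal.Quotient.mk (Ideal.span {f}) (X j)))
    (𝔪 : Ideal (MvPolynomial (Fin 5) k ⧸ Ideal.span {f})) (h𝔪 : 𝔪 = Ideal.span (Set.range fun j : Fin 5 => Ideal.Quotient.mk (Ideal.span {f}) (X j))) :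
    TStepGerm.TStepInstanceAt p v ((affineBlowup.idealSheaf 𝔪).comap ((Spec (.of (MvPolynomial (Fin 5) k ⧸ Ideal.span {f}))).fromSpecStalk v)) :=
  tStepInstanceAt_x2cubic4_origin k (X2Cubic4Specimen.two_three_ne_zero k p hp2 hp3).1 (X2Cubic4Specimen.two_three_ne_zero k p hp2 hp3).2 p f hf v hv 𝔪 h𝔪

end Summit.ResolutionOfSingularities.ResolutionOfSingularities.Theorems.FInjectiveMacaulayfication.X2Cubic4FloorTwoGlue

end
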